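import Mathlib
import Summits.HodgeConjecture.FermatCycles.HodgeFermatMuEven
import Summits.HodgeConjecture.FermatCycles.HodgeFermatNuOdd
import Summits.HodgeConjecture.FermatCycles.HodgeFermatThmFstar

/-!
# LEMMA E (μ- and ν-part, m₀ = 3), THEOREM (μ even), THEOREM (ν odd) and THEOREM (Σν) at prime levels — UNCONDITIONAL final forms (`HodgeFermat/LemmaEMuFinal.lean` + `LemmaENuFinal.lean` + `NuOddFinal.lean`; HF-G31c/d/e)

Tree copy of 3 SMALL MODULES of the sibling cell's standalone package `run/shared/lean/pub/pub-hodgefermat/lean/HodgeFermat/`,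
concatenated in one tree file (each module's body byte-identical to its source lines, its own `namespace … end` block kept;
the precedent is `HodgeFermatPropDPrimeNFinal.lean`).  They are the hypothesis-free («final») forms of the DPRIME §6–§7
theorems whose `H0`-conditional forms this unit landed with THEOREM F* (gen-0: `HodgeFermatLemmaEMu.lean`, `HodgeFermatMuEven.lean`,
`HodgeFermatLemmaENu.lean`, `HodgeFermatNuChar.lean`, `HodgeFermatNuOdd.lean`), `H0` (the Hurwitz value `ζ(0, x) = 1/2 − x`) being
the landed theorem `HodgeFermat.KRFree.DecodingFinal.h0` (`HodgeFermatThmFstar.lean`):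
  1. `HodgeFermat/LemmaEMuFinal.lean` (50 lines, sha256 `f21e42870b96599c…`), source lines 16–18 and 23–50 (`lemmaE_mu` — LEMMA E,
     μ-part, for every odd Dirichlet character mod a prime `p ≠ 3` —, `moment_ne_zero` — `S_p(ψ) ≠ 0` —, `mu_even` — THEOREM
     (μ even)) — pub-hodgefermat `CERT.md` l.969, GATE HF-G31c; cell record `check/LemmaEMuFinal_standalone.lean` (22 bodies);
  2. `HodgeFermat/LemmaENuFinal.lean` (55 lines, sha256 `1bdc0c1e035d7508…`), source lines 17–19 and 24–55 (`lemmaE_nu` — LEMMA E,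
     ν-part, for every odd character mod `3p` of conductor `3p` —, `moment_ne_zero₃`, `lemmaE_nu3` — LEMMA E at `χ₃ × ψ`, `ψ` even
     non-trivial) — `CERT.md` l.972, GATE HF-G31d; cell record `check/LemmaENuFinal_standalone.lean` (23 bodies);
  3. `HodgeFermat/NuOddFinal.lean` (46 lines, sha256 `583c60aa28b9937b…`), source lines 17–20 and 25–46 (`nu_odd` — THEOREM (ν odd)
     at every prime `p ≥ 17` —, `nu_sum_eq` — THEOREM (Σν): `χ₃(a)+χ₃(b)+χ₃(c) = χ₃(a′)+χ₃(b′)+χ₃(c′)` for same-type triples at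
     every prime level `p ≥ 17`) — `CERT.md` l.975, GATE HF-G31e; cell record `check/NuOddFinal_standalone.lean` (24 bodies).
Filed by cell `pub-hfermat`, seat prover-1 gen-5, on the COORDINATOR KEEPER RULING of 2026-08-25 (gem sweep H1: take the
off-gate kernel theorem `thmFstar` through the gate).  Every form of THEOREM F* of the sibling package is on-gate since
2026-08-25/26 (`HodgeFermatThmFstar.lean` = F*(3p), HF-G32, seat gen-0; `HodgeFermatThmFstarN.lean` = F*(3N), HF-G33, gen-2;
`HodgeFermatPropDPrimeNFinal.lean` = PROPOSITION D′(3N) + THE DESCENT, HF-G34, gen-3; `HodgeFermatDPrimePrime.lean` = D′(3p),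
HF-G32, and `HodgeFermatDescentBFinal.lean` = the descent at 15N/21N, HF-G34b, gen-4); this generation files, by the same
verbatim-port protocol, the sibling's remaining off-gate named gate theorems nearest to that chain: THEOREM B2 (HF-G28b),
the unconditional final forms of LEMMA E / THEOREM (μ even) / (ν odd) / (Σν) at prime levels (HF-G31c/d/e), COROLLARY M
with its seventh clause (HF-G31) and THEOREM U⁼ with the list of exceptions in no-binder form (HF-G27d).
Deviations from the source modules, exhaustively: the `import` lines (tree modules `…HodgeFermatMuEven` for `import HodgeFermat.MuEven`,
`…HodgeFermatNuOdd` for `import HodgeFermat.NuOdd` and, through it, `HodgeFermat.NuChar`; `…HodgeFermatThmFstar` stands for the three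
`import HodgeFermat.HurwitzZero` lines — see the DEDUP note); this docstring (replacing the modules' docstrings, all three quoted
below); ONE DEDUP deletion per module, re-bound so that every use site stays byte-identical: each module's
`theorem h0 : H0 := HodgeFermat.KRFree.HurwitzZero.hypH0` (source `LemmaEMuFinal.lean` l.20–21, `LemmaENuFinal.lean` l.21–22,
`NuOddFinal.lean` l.22–23) is NOT re-declared — it is, statement (`LemmaEMu.H0`) and content (the Hurwitz value), the landed
`HodgeFermat.KRFree.DecodingFinal.h0` of `HodgeFermatThmFstar.lean`, brought into scope by `open HodgeFermat.KRFree.DecodingFinal (h0)`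
in each block (the precedent is `HodgeFermatThmFstarN.lean`, gen-2).  Every other line — in particular every declaration's statement
and proof — is byte-identical to its source.
Trust base: no hypotheses beyond the displayed binders, no `sorry`; axioms = [propext, Classical.choice, Quot.sound].
HONEST FRAMING: explicit algebraic cycles for specific Hodge classes on Fermat/Delsarte varieties; residual open instances
listed; no claim on general Hodge.  (This file is arithmetic of CM types / finite combinatorics of the sibling's KR-free
programme; it claims nothing about cycles.)

(1) The docstring of `HodgeFermat/LemmaEMuFinal.lean` (l.4–14), verbatim:

## LEMMA E (μ-part, m₀ = 3) and THEOREM (μ even) at prime levels — unconditional (HF-G31c, final form)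

`HodgeFermat/LemmaEMu.lean` proves LEMMA E's μ-part for every odd Dirichlet character mod a prime `p ≠ 3`, and
`HodgeFermat/MuEven.lean` its character-free consequence "μ_T − μ_T′ is even on ℤ/p" (DPRIME §7.1), both from the
Hurwitz special value `H0` (`ζ(0, x) = 1/2 − x`); `HodgeFermat/HurwitzZero.lean` (generation 23) proves exactly that
statement (`hypH0 : HypBReduction.HypH0`, the same term as `LemmaEMu.H0`).  This module puts them together:
`h0 : LemmaEMu.H0` and the hypothesis-free `lemmaE_mu`, `moment_ne_zero`, `mu_even`.  Heavy import (the analytic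
chain of 17 modules); hub record `check/LemmaEMuFinal_standalone.lean` (22 bodies).  NOT imported by the root
`HodgeFermat.lean`.

(2) The docstring of `HodgeFermat/LemmaENuFinal.lean` (l.4–15), verbatim:

## LEMMA E (ν-part, m₀ = 3) at prime levels — unconditional (HF-G31d, final form)

`HodgeFermat/LemmaENu.lean` proves LEMMA E's ν-part (`tables/DPRIME-THEOREM.md` §6, `m₀ = 3`) at a prime level `p`
for every odd Dirichlet character mod `3p` that is non-trivial on the kernels of both reductions (conductor `3p`),
and `HodgeFermat/NuChar.lean` instantiates it at `χ = χ₃ × ψ`, `ψ` even and non-trivial mod `p` ("ν̂_T(ψ̄) = ν̂_T′(ψ̄)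
for every even ψ ≠ 1", DPRIME §7.1) — both from the Hurwitz special value `H0` (`ζ(0, x) = 1/2 − x`).
`HodgeFermat/HurwitzZero.lean` (generation 23) proves exactly that statement (`hypH0 : HypBReduction.HypH0`, the same
term as `LemmaEMu.H0`).  This module puts them together: the hypothesis-free `lemmaE_nu`, `moment_ne_zero₃`,
`lemmaE_nu3`.  Heavy import (the analytic chain of 17 modules); hub record `check/LemmaENuFinal_standalone.lean`
(23 bodies).  NOT imported by the root `HodgeFermat.lean`.

(3) The docstring of `HodgeFermat/NuOddFinal.lean` (l.4–15), verbatim: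

## THEOREM (ν odd) and THEOREM (Σν at every prime p ≥ 17) — unconditional (HF-G31e, final form)

`HodgeFermat/NuOdd.lean` proves, from the Hurwitz special value `H0` (`ζ(0, x) = 1/2 − x`) via LEMMA E at
`χ₃ × ψ` (`NuChar.lemmaE_nu3`), Fourier inversion on `(ℤ/p)ˣ` and a support count, that for a prime `p ≥ 17` and
two zero-sum same-type triples mod `3p` with entries prime to `p` the integer function `ν_T − ν_T′` on `ℤ/p` is ODD
(DPRIME §7.1, second half) and `χ₃(a) + χ₃(b) + χ₃(c) = χ₃(a′) + χ₃(b′) + χ₃(c′)` (THEOREM (Σν) at every prime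
level `p ≥ 17`, also `p ≡ 1 (mod 3)`).  `HodgeFermat/HurwitzZero.lean` (generation 23) proves `H0`
(`hypH0 : HypBReduction.HypH0`, the same term as `LemmaEMu.H0`).  This module puts them together: the
hypothesis-free `nu_odd`, `nu_sum_eq`.  Heavy import (the analytic chain of 17 modules); hub record
`check/NuOddFinal_standalone.lean` (24 bodies).  NOT imported by the root `HodgeFermat.lean`.
-/

-- ════════════════════════════════════════════════════════════════════════════════════════════════
-- module 1/3: HodgeFermat/LemmaEMuFinal.lean (source lines 16–18, 23–50)
-- ════════════════════════════════════════════════════════════════════════════════════════════════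

namespace HodgeFermat.KRFree.LemmaEMuFinal

open HodgeFermat.KRFree.LemmaN HodgeFermat.KRFree.LemmaEMu HodgeFermat.KRFree.MuEven
open HodgeFermat.KRFree.DecodingFinal (h0)

-- `theorem h0 : H0 := HodgeFermat.KRFree.HurwitzZero.hypH0` (source): NOT re-declared — it is, statement and content, the
-- landed `HodgeFermat.KRFree.DecodingFinal.h0` (`HodgeFermatThmFstar.lean`, the Hurwitz value ζ(0, x) = 1/2 − x), opened above
-- (DEDUP; the precedent is `HodgeFermatThmFstarN.lean`).

/-- **LEMMA E (μ-part, m₀ = 3, prime level) — unconditional.**  For a prime `p ≠ 3`, an odd Dirichlet character `ψ`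
mod `p`, and two zero-sum triples mod `3p` with entries prime to `p` and the same CM type:
`ê(a) + ê(b) + ê(c) = ê(a′) + ê(b′) + ê(c′)`, `ê(x) = (1 − ψ(3))·ψ⁻¹(x)` (`3 ∤ x`), `2·ψ⁻¹(x/3)` (`3 ∣ x`). -/
theorem lemmaE_mu {p : ℕ} (hp : p.Prime) (hp3 : p ≠ 3) (ψ : DirichletCharacter ℂ p) (hψ : ψ.Odd)
    {a b c a' b' c' : ℕ} (hs : 3 * p ∣ a + b + c) (hs' : 3 * p ∣ a' + b' + c')
    (ha : Nat.Coprime a p) (hb : Nat.Coprime b p) (hc : Nat.Coprime c p)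
    (ha' : Nat.Coprime a' p) (hb' : Nat.Coprime b' p) (hc' : Nat.Coprime c' p)
    (hT : SameType (3 * p) (a, b, c) (a', b', c')) :
    ehat ψ a + ehat ψ b + ehat ψ c = ehat ψ a' + ehat ψ b' + ehat ψ c' :=
  LemmaEMu.lemmaE_mu h0 hp hp3 ψ hψ hs hs' ha hb hc ha' hb' hc' hT

/-- `S_p(ψ) = Σ_{u unit} ψ(u)·u ≠ 0` for every odd `ψ` mod a prime `p` — unconditional. -/
theorem moment_ne_zero {p : ℕ} (hp : p.Prime) (ψ : DirichletCharacter ℂ p) (hψ : ψ.Odd) :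
    HodgeFermat.KRFree.TwistedMoment.moment p (toFun ψ) ≠ 0 := by
  haveI : NeZero p := ⟨hp.ne_zero⟩
  exact LemmaEMu.moment_ne_zero h0 hp ψ hψ

/-- **THEOREM (μ even) — unconditional.**  For a prime `p ≠ 3` and two zero-sum triples mod `3p` with entries prime
to `p` and the same CM type, `μ_T − μ_T′` is an even function on `ℤ/p` (DPRIME §7.1; `MuEven.muFun`). -/
theorem mu_even {p : ℕ} (hp : p.Prime) (hp3 : p ≠ 3)
    {a b c a' b' c' : ℕ} (hs : 3 * p ∣ a + b + c) (hs' : 3 * p ∣ a' + b' + c')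
    (ha : Nat.Coprime a p) (hb : Nat.Coprime b p) (hc : Nat.Coprime c p)
    (ha' : Nat.Coprime a' p) (hb' : Nat.Coprime b' p) (hc' : Nat.Coprime c' p)
    (hT : SameType (3 * p) (a, b, c) (a', b', c')) (x : ZMod p) :
    muFun (a, b, c) (-x) - muFun (a', b', c') (-x) = muFun (a, b, c) x - muFun (a', b', c') x :=
  MuEven.mu_even h0 hp hp3 hs hs' ha hb hc ha' hb' hc' hT x

end HodgeFermat.KRFree.LemmaEMuFinal

-- ════════════════════════════════════════════════════════════════════════════════════════════════
-- module 2/3: HodgeFermat/LemmaENuFinal.lean (source lines 17–19, 24–55)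
-- ════════════════════════════════════════════════════════════════════════════════════════════════

namespace HodgeFermat.KRFree.LemmaENuFinal

open HodgeFermat.KRFree.LemmaN HodgeFermat.KRFree.LemmaEMu HodgeFermat.KRFree.LemmaENu HodgeFermat.KRFree.NuChar
open HodgeFermat.KRFree.DecodingFinal (h0)

-- `theorem h0 : H0 := HodgeFermat.KRFree.HurwitzZero.hypH0` (source): NOT re-declared — it is, statement and content, the
-- landed `HodgeFermat.KRFree.DecodingFinal.h0` (`HodgeFermatThmFstar.lean`, the Hurwitz value ζ(0, x) = 1/2 − x), opened above
-- (DEDUP; the precedent is `HodgeFermatThmFstarN.lean`).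

/-- **LEMMA E (ν-part, m₀ = 3, prime level) — unconditional.**  For a prime `p ≠ 3`, an odd Dirichlet character `χ`
mod `3p` with `χ ≠ 1` at the units `j ≡ 2 (3), j ≡ 1 (p)` and at some unit `k ≡ 1 (3)`, and two zero-sum triples mod
`3p` with entries prime to `p` and the same CM type: `Σ_{x ∈ T, 3 ∤ x} χ⁻¹(x) = Σ_{x ∈ T′, 3 ∤ x} χ⁻¹(x)`. -/
theorem lemmaE_nu {p : ℕ} (hp : p.Prime) (hp3 : p ≠ 3) (χ : DirichletCharacter ℂ (3 * p)) (hχ : χ.Odd)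
    (hram : ∀ j : ℕ, Nat.Coprime j (3 * p) → j % 3 = 2 → j % p = 1 % p → χ (j : ZMod (3 * p)) ≠ 1)
    (hB : ∃ k : ℕ, Nat.Coprime k (3 * p) ∧ k % 3 = 1 ∧ χ (k : ZMod (3 * p)) ≠ 1)
    {a b c a' b' c' : ℕ} (hs : 3 * p ∣ a + b + c) (hs' : 3 * p ∣ a' + b' + c')
    (ha : Nat.Coprime a p) (hb : Nat.Coprime b p) (hc : Nat.Coprime c p)
    (ha' : Nat.Coprime a' p) (hb' : Nat.Coprime b' p) (hc' : Nat.Coprime c' p)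
    (hT : SameType (3 * p) (a, b, c) (a', b', c')) :
    nhat χ a + nhat χ b + nhat χ c = nhat χ a' + nhat χ b' + nhat χ c' :=
  LemmaENu.lemmaE_nu h0 hp hp3 χ hχ hram hB hs hs' ha hb hc ha' hb' hc' hT

/-- `S_{3p}(χ) = Σ_{u unit mod 3p} χ(u)·u ≠ 0` for every odd `χ` mod `3p` of conductor `3p` — unconditional. -/
theorem moment_ne_zero₃ {p : ℕ} (hp : p.Prime) (χ : DirichletCharacter ℂ (3 * p)) (hχ : χ.Odd)
    (hA : ∃ j : ℕ, Nat.Coprime j (3 * p) ∧ j % p = 1 % p ∧ χ (j : ZMod (3 * p)) ≠ 1)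
    (hB : ∃ k : ℕ, Nat.Coprime k (3 * p) ∧ k % 3 = 1 ∧ χ (k : ZMod (3 * p)) ≠ 1) :
    HodgeFermat.KRFree.TwistedMoment.moment (3 * p) (toFun χ) ≠ 0 :=
  LemmaENu.moment_ne_zero₃ h0 hp χ hχ hA hB

/-- **LEMMA E (ν-part, m₀ = 3, prime level) for `χ₃ × ψ` — unconditional.**  For a prime `p ≠ 3`, an EVEN Dirichlet
character `ψ ≠ 1` mod `p`, and two zero-sum triples mod `3p` with entries prime to `p` and the same CM type:
`Σ_{x ∈ T, 3 ∤ x} χ₃(x)ψ⁻¹(x) = Σ_{x ∈ T′, 3 ∤ x} χ₃(x)ψ⁻¹(x)` ("ν̂_T(ψ̄) = ν̂_T′(ψ̄) for every even ψ ≠ 1", DPRIME §7.1). -/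
theorem lemmaE_nu3 {p : ℕ} (hp : p.Prime) (hp3 : p ≠ 3) (ψ : DirichletCharacter ℂ p) (hψ : ψ.Even) (hψ1 : ψ ≠ 1)
    {a b c a' b' c' : ℕ} (hs : 3 * p ∣ a + b + c) (hs' : 3 * p ∣ a' + b' + c')
    (ha : Nat.Coprime a p) (hb : Nat.Coprime b p) (hc : Nat.Coprime c p)
    (ha' : Nat.Coprime a' p) (hb' : Nat.Coprime b' p) (hc' : Nat.Coprime c' p)
    (hT : SameType (3 * p) (a, b, c) (a', b', c')) :
    nu3 ψ a + nu3 ψ b + nu3 ψ c = nu3 ψ a' + nu3 ψ b' + nu3 ψ c' :=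
  NuChar.lemmaE_nu3 h0 hp hp3 ψ hψ hψ1 hs hs' ha hb hc ha' hb' hc' hT

end HodgeFermat.KRFree.LemmaENuFinal

-- ════════════════════════════════════════════════════════════════════════════════════════════════
-- module 3/3: HodgeFermat/NuOddFinal.lean (source lines 17–20, 25–46)
-- ════════════════════════════════════════════════════════════════════════════════════════════════

namespace HodgeFermat.KRFree.NuOddFinal

open HodgeFermat.KRFree.LemmaN HodgeFermat.KRFree.LemmaEMu HodgeFermat.KRFree.NuOdd
open HodgeFermat.KRFree.ChiThree (chi3)
open HodgeFermat.KRFree.DecodingFinal (h0)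

-- `theorem h0 : H0 := HodgeFermat.KRFree.HurwitzZero.hypH0` (source): NOT re-declared — it is, statement and content, the
-- landed `HodgeFermat.KRFree.DecodingFinal.h0` (`HodgeFermatThmFstar.lean`, the Hurwitz value ζ(0, x) = 1/2 − x), opened above
-- (DEDUP; the precedent is `HodgeFermatThmFstarN.lean`).

/-- **THEOREM (ν odd) — unconditional.**  For a prime `p ≥ 17` and two zero-sum triples mod `3p` with entries prime
to `p` and the same CM type, `ν_T − ν_T′` is an odd function on `ℤ/p`:
`(ν_T − ν_T′)(−x) = −(ν_T − ν_T′)(x)`, where `ν_T(x) = Σ_{a ∈ T, 3 ∤ a, a ≡ x (p)} χ₃(a)` (`NuOdd.nuFun`). -/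
theorem nu_odd {p : ℕ} (hp : p.Prime) (hp17 : 17 ≤ p)
    {a b c a' b' c' : ℕ} (hs : 3 * p ∣ a + b + c) (hs' : 3 * p ∣ a' + b' + c')
    (ha : Nat.Coprime a p) (hb : Nat.Coprime b p) (hc : Nat.Coprime c p)
    (ha' : Nat.Coprime a' p) (hb' : Nat.Coprime b' p) (hc' : Nat.Coprime c' p)
    (hT : SameType (3 * p) (a, b, c) (a', b', c')) (x : ZMod p) :
    nuFun (a, b, c) (-x) - nuFun (a', b', c') (-x) = -(nuFun (a, b, c) x - nuFun (a', b', c') x) :=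
  NuOdd.nu_odd h0 hp hp17 hs hs' ha hb hc ha' hb' hc' hT x

/-- **THEOREM (Σν at every prime p ≥ 17) — unconditional.**  For a prime `p ≥ 17` and two zero-sum triples mod `3p`
with entries prime to `p` and the same CM type, `χ₃(a) + χ₃(b) + χ₃(c) = χ₃(a′) + χ₃(b′) + χ₃(c′)`. -/
theorem nu_sum_eq {p : ℕ} (hp : p.Prime) (hp17 : 17 ≤ p)
    {a b c a' b' c' : ℕ} (hs : 3 * p ∣ a + b + c) (hs' : 3 * p ∣ a' + b' + c')
    (ha : Nat.Coprime a p) (hb : Nat.Coprime b p) (hc : Nat.Coprime c p)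
    (ha' : Nat.Coprime a' p) (hb' : Nat.Coprime b' p) (hc' : Nat.Coprime c' p)
    (hT : SameType (3 * p) (a, b, c) (a', b', c')) :
    chi3 a + chi3 b + chi3 c = chi3 a' + chi3 b' + chi3 c' :=
  NuOdd.nu_sum_eq h0 hp hp17 hs hs' ha hb hc ha' hb' hc' hT

end HodgeFermat.KRFree.NuOddFinal
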